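import Literature.RepresentationTheory.BergeronMillsonMoeglin2016.ArchimedeanSignature
import HarnessLib

/-!
# Bergeron–Millson–Moeglin 2016: the structure of the printed proof of Theorem 7.2 (Acta pp. 65–66) —
# Proposition 13.4, the global-to-local step (a printed theorem in the stable range) and Paul's sentence, CERTIFIED

AS PRINTED, N. Bergeron, J. Millson, C. Moeglin, *The Hodge conjecture and arithmetic quotients of complex balls*,
Acta Math. 216 (2016) 1–125 [BergeronMillsonMoeglin2016Balls] (= arXiv:1306.1515v3, held as chunks):

* **Theorem 7.2** (p. 65; arXiv Thm 7.8): typed in the imported module as `BMMSpectrum.Thm_7_2`.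
* Its printed PROOF (pp. 65–66; arXiv chunk p0034 L38–40): "The proof of this theorem is the goal of Part 3. There we
  work with unitary groups rather than similitude groups. To be more precise the theorem follows from Proposition 13.4
  which is stated and proved in Part 3.  The only remaining thing to be proved is that the signature at infinity is
  `(a,b)`: this follows from the fact that `A(b×q, a×q)` is the image of the local theta correspondance from a group
  `U(W, ℂ/ℝ)` of dimension `a+b` if and only if the signature is `(a,b)`.  This follows from work of Annegret Paul
  [61]."  (Acta wording of the last sentence: module docstring of `…/ArchimedeanSignature.lean`.)
* **Proposition 13.4** (Part 3; arXiv Prop. 13.4 = flattened "Proposition 82", chunk p0055 L18–22): "Let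
  `π ∈ 𝒜^c(U(V))` and let `v` be an infinite place of `F` such that `U(V)(F_v) ≅ U(p,q)`.  Assume that `π_v` is
  (isomorphic to) the cohomological representation `A(b×q, a×q)` of `U(p,q)` with `3(a+b)+|a−b| < 2m`.  Then, there
  exists some `(a+b)`-dimensional skew-Hermitian space `W` over `E` such that `π` is in the image of the cuspidal
  `ψ`-theta correspondence from the group `U(W)`."

WHAT IS REPRODUCED.  Over the carriers `BMMArchSpectrum` of `…/ArchimedeanSignature.lean` (nothing new is posited):
(1) `Prop_13_4` — the proposition, typed for the `π = A(b×q,a×q) ⊗ π_f`, `π_f ∈ Coh_f^{b,a}`, that Theorem 7.2 is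
about (the form in which the printed proof invokes it); (2) `GlobalToLocal` — the INFERENCE the printed proof uses
between Proposition 13.4 and Paul's sentence and does not spell out: a global `ψ`-theta lift from `U(W)` has its
archimedean component (at the place `v₀` with `U(V)(F_{v₀}) ≅ U(p,q)`) in the image of the LOCAL theta
correspondence from `U(W ⊗ ℝ) = U(W, ℂ/ℝ)`, a group of signature `sig_∞(W)`.  It is labelled for what it is — a step
of a printed proof, i.e. the compatibility of the global theta correspondence with the local Howe correspondence at
an archimedean place.  In print this compatibility is the localisation argument of S. Rallis, *On the Howe duality
conjecture*, Compositio Math. 51 (1984) 333–399 [Rallis1984], proof of Theorem 1.2.2, p. 356 (orthogonal–symplectic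
pairs: a non-zero global pairing between `Θ(π)` and a cusp form `σ` yields, "for each `v`, a prime in `K`, a nonzero
`O(Q_v) × Sp_n(K_v)` invariant bilinear form on the local space `S[M_{mn}(K_v)] ⊗ π_v ⊗ σ_v`"), and, by
construction, S. Gelbart, I. Piatetski-Shapiro, LNM 1041 (1984) §6 (6.6)–(6.7) for `U(2,1)` with `V` isotropic
(`ω_ψ^χ = ⊗_v ω_{ψ_v}^{χ_v}` realised in the automorphic forms by `Φ ↦ Θ_Φ`).  NOTHING IS ASSERTED: both are
`Prop`-valued definitions taken as hypotheses by name.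
(3) PROVED: `thm_7_2_of_prop_13_4 : Prop_13_4 → GlobalToLocal → ArchSignature → Thm_7_2` — the printed proof,
kernel-checked: Proposition 13.4 supplies `W` with `dim W = a+b` and the global lift; the global-to-local step makes
`A(b×q,a×q)` a local lift from `U(W, ℂ/ℝ)` of signature `sig_∞(W)`; Paul's sentence (`ArchSignature`) forces
`sig_∞(W) = (a,b)`.  Also the signature corollary `sigInf_eq_of_isThetaLiftFrom` and its degree-one form.
(4) `GlobalToLocalDeg` — the WEAKEST form of (2) the printed proof actually consumes (only for `π_∞ = A(b×q,a×q)`,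
`dim W = a+b`, under `3(a+b)+|a−b| < 2m`), with `thm_7_2_of_prop_13_4_deg`; and **`GlobalToLocalStable` — the same
inference in the STABLE RANGE `2·dim W < m`, where it IS a printed theorem**: J.-S. Li's stable-range theorem AS
PRINTED in M. Cossutta, S. Marshall, *Theta lifting and cohomology growth in `p`-adic towers*, IMRN 2013 (11)
2601–2623 [CossuttaMarshall2012] (= arXiv:1106.2765, held as chunks; §2 "The Global Theta Lift", chunk p0007
L61–65, the theorem displayed there — numbered "Theorem 6" in the held text — attributed to "[Li2]" = J.-S. Li,
J. reine angew. Math. 428 (1992) 177–217 [Li1992]): "In general, `θ_φ(f,h)` is a smooth function of moderate growth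
on `G(F)\G(𝔸)`.  However, if we assume in addition that `n > 2n' + 4d − 2` then the following theorem was proven by
Li in [Li2].  THEOREM. `θ_φ(f,h)` is square integrable, and nonzero for some choice of `f ∈ π` and `φ ∈ S(X(𝔸))`.
If `Θ(π,V)` is the subspace of `L²(G(F)\G(𝔸))` generated by the functions `θ_φ(f,h)` under the action of `G(𝔸)`,
then `Θ(π,V)` is an irreducible automorphic representation which is isomorphic to `⊗_v θ(π_v, V_v)`."  Setting
(chunk p0003): `F` totally real, `E/F` quadratic ("case 2", `d = 1/2`), `V`, `V'` (−)Hermitian of dimensions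
`n ≥ n'`, `G = U(V)`, `G' = U(V')`, `π` a cusp form on `G'`; `θ(π_v, V_v)` = the unique irreducible quotient of the
local big theta lift (chunk p0006, Howe at archimedean `v`).  In case 2 the hypothesis reads `n > 2n'`.  TYPED
CONSEQUENCE at the distinguished archimedean place (BMM's `W` = C–M's `V'`, `m = n`): if `π_∞ ⊗ π_f` is in the image
of the cuspidal `ψ`-theta correspondence from `U(W)` (BMM Def. 7.5: `= Θ(π')`, `π'` cuspidal on `U(W)`) and
`2·dim W < m`, then `π_∞ ≅ θ(π'_∞, V_∞)` is in the image of the LOCAL theta correspondence from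
`U(W)(F_∞) = U(W, ℂ/ℝ)`, a group of signature `sig_∞(W)`.  PROVED: at `m = 3` every `(a,b)` with
`3(a+b)+|a−b| < 6` has `a+b ≤ 1`, so `2(a+b) < 3` (`two_mul_add_lt_of_degreeBound_three`) and
`GlobalToLocalStable → GlobalToLocalDeg` (`globalToLocalDeg_of_stable`); hence
**`thm_7_2_of_prop_13_4_stable : m = 3 → Prop_13_4 → GlobalToLocalStable → ArchSignature → Thm_7_2`** — at `m = 3`
(Picard modular surfaces, lifts from `U(1)`) the printed proof of Theorem 7.2 runs on PRINTED statements only.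
"PRINTED" is NOT "unconditional": of the three printed inputs, Proposition 13.4 is the one whose own proof (Part 3,
§§12–13) carries the source's stated dependence on Arthur's endoscopic classification — Acta §1.4 pp. 8–9 ("This
relies on Arthur's recent endoscopic classification of automorphic representations of classical groups … through the
stabilization of the twisted trace formula recently obtained by Moeglin and Waldspurger [58]"), §12.5 p. 94 with
footnote (13) and Appendix A.2, Theorem A.4 pp. 109–110 for the non-quasi-split `G` ("(When Kaletha, Minguez, Shin
and White have finished their three announced papers, this will be included.)"), arXiv v3 §1.9 ("our work is still
conditional …"); the full quotations and later print on that status are in the module docstring of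
`…/ThetaLiftExhaustion.lean` (§ STATUS OF THE SOURCE / STATUS IN LATER PRINT).  A consumer of `(h : X.Prop_13_4)`
inherits exactly that printed dependence.

NOT here: Part 3 itself (the proof of Proposition 13.4 via Arthur's classification and poles of partial
`L`-functions), Paul's parametrisation, the groups.  The numbering `13.4` is the Acta / arXiv-v3 section numbering
quoted on Acta p. 65 ("It is a corollary of Proposition 13.4 below whose proof is the goal of Part 3").

## References

* [BergeronMillsonMoeglin2016Balls] Acta Math. 216 (2016): Thm 7.2 p. 65, its proof pp. 65–66, Prop. 13.4 (Part 3).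
* [Paul1998] A. Paul, J. Funct. Anal. 159 (1998) 384–431 — BMM's [61].
* [Rallis1984] S. Rallis, Compositio Math. 51 (1984) 333–399: Thm 1.2.2 p. 355 and its proof p. 356.
* [CossuttaMarshall2012] M. Cossutta, S. Marshall, IMRN 2013 (11) 2601–2623 (arXiv:1106.2765): §2, the theorem after
  "(2.3)" attributed to [Li2] (held chunk p0007 L61–65).
* [Li1992] J.-S. Li, J. reine angew. Math. 428 (1992) 177–217 (not held; acq-07570, cite-only) — C–M's [Li2].
-/

namespace Literature.RepresentationTheory.BergeronMillsonMoeglin2016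

universe u

namespace BMMArchSpectrum

variable {X : BMMArchSpectrum.{u}}

/-- **Proposition 13.4**, AS PRINTED [BergeronMillsonMoeglin2016Balls, Prop. 13.4 (Part 3); arXiv:1306.1515v3 chunk
p0055 L18–22]: "Let `π ∈ 𝒜^c(U(V))` and let `v` be an infinite place of `F` such that `U(V)(F_v) ≅ U(p,q)`.  Assume
that `π_v` is (isomorphic to) the cohomological representation `A(b×q, a×q)` of `U(p,q)` with `3(a+b)+|a−b| < 2m`.
Then, there exists some `(a+b)`-dimensional skew-Hermitian space `W` over `E` such that `π` is in the image of the
cuspidal `ψ`-theta correspondence from the group `U(W)`."  TYPED for `π = A(b×q, a×q) ⊗ π_f` with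
`π_f ∈ Coh_f^{b,a}` (the representations Theorem 7.2 applies it to): under `degreeBound a b` there is `W` with
`dimW W = a + b` and `IsThetaLiftFrom (A b a) π_f W`.  Nothing is asserted.  PUBLISHED LOCATOR: Acta 216, p. 102
[Project-Euclid PDF 106 L7–11], word-identical to the arXiv v3 text; printed lead-in (p. 102 L5–6): "Therefore
from Theorem 10.1, Proposition 13.2 and the paragraph following it, we deduce the following result."  STATUS OF THE
PRINTED PROOF (quoted, not adjudicated): this is the Part-3 statement whose proof the source routes through Arthur's
endoscopic classification and the Moeglin–Waldspurger stabilisation of the twisted trace formula (Acta §1.4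
pp. 8–9), with the reduction for the non-quasi-split `G` of the paper in §12.5 p. 94, footnote (13), and
Appendix A.2, Theorem A.4 pp. 109–110, printed with "(When Kaletha, Minguez, Shin and White have finished their
three announced papers, this will be included.)"; arXiv v3 §1.9: "our work is still conditional on extensions to
the twisted case of results which have only been proved so far in the case of connected groups".  Standing
hypotheses as for `BMMSpectrum.Thm_7_2` (`d = [F:ℚ] ≥ 2`, `V` anisotropic of signature `(p,q)` at `τ_1` with
`p ≥ q ≥ 1`, definite elsewhere, `K` neat, trivial coefficients — published §1.1 p. 1, §6.1 p. 54).  Full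
quotations: module docstring of `…/ThetaLiftExhaustion.lean`.
[cite: BergeronMillsonMoeglin2016Balls, Proposition 13.4, p. 102] -/
def Prop_13_4 (X : BMMArchSpectrum.{u}) : Prop :=
  ∀ (a b : ℕ) (πf : X.RepF), X.degreeBound a b → πf ∈ X.CohF b a →
    ∃ W : X.SkewHerm, X.dimW W = a + b ∧ X.IsThetaLiftFrom (X.A b a) πf W

/-- **The global-to-local step of the printed proof of Theorem 7.2** [BergeronMillsonMoeglin2016Balls, pp. 65–66]:
between "`π` is in the image of the `ψ`-theta correspondence from `U(W)`" (Proposition 13.4) and "`A(b×q, a×q)` is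
the image of the LOCAL theta correspondence from a group `U(W, ℂ/ℝ)` of dimension `a+b` iff the signature is
`(a,b)`" (after [Paul1998]) the proof uses: if `π = π_∞ ⊗ π_f` is a global `ψ`-theta lift from `U(W)`, then `π_∞`
is in the image of the local theta correspondence from `U(W ⊗ ℝ) = U(W, ℂ/ℝ)`, a group of signature `sig_∞(W)`.
TYPED: `IsThetaLiftFrom π_∞ π_f W → IsLocalThetaLiftFrom π_∞ (sigInf W)`.  LABEL: a step of a printed proof
(compatibility of the global theta correspondence with the local Howe correspondence at the archimedean place; the
localisation argument is printed for orthogonal–symplectic pairs in [Rallis1984], proof of Thm 1.2.2, p. 356).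
Nothing is asserted. [cite: BergeronMillsonMoeglin2016Balls, proof of Thm 7.2 pp. 65–66] -/
def GlobalToLocal (X : BMMArchSpectrum.{u}) : Prop :=
  ∀ (πinf : X.CohInf) (πf : X.RepF) (W : X.SkewHerm),
    X.IsThetaLiftFrom πinf πf W → X.IsLocalThetaLiftFrom πinf (X.sigInf W)

/-- K. **The signature of the lifting group is forced**: under `3(a+b)+|a−b| < 2m`, if `A(b×q,a×q) ⊗ π_f` is a global
`ψ`-theta lift from `U(W)` with `dim W = a + b`, then `W` has signature `(a,b)` at infinity — the last step of the
printed proof of Theorem 7.2 ("the only remaining thing to be proved is that the signature at infinity is `(a,b)`"),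
from the global-to-local step and Paul's sentence. [cite: BergeronMillsonMoeglin2016Balls, proof of Thm 7.2 pp. 65–66] -/
theorem sigInf_eq_of_isThetaLiftFrom (hG : X.GlobalToLocal) (hS : X.ArchSignature) {a b : ℕ} {πf : X.RepF}
    {W : X.SkewHerm} (hdeg : X.degreeBound a b) (hdim : X.dimW W = a + b)
    (hW : X.IsThetaLiftFrom (X.A b a) πf W) : X.sigInf W = (a, b) := by
  have hloc : X.IsLocalThetaLiftFrom (X.A b a) ((X.sigInf W).1, (X.sigInf W).2) := hG _ _ _ hW
  exact (hS a b (X.sigInf W).1 (X.sigInf W).2 hdeg hdim).mp hloc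

/-- K. **The printed proof of Theorem 7.2, certified**: Proposition 13.4, the global-to-local step and Paul's
signature sentence imply Theorem 7.2. [cite: BergeronMillsonMoeglin2016Balls, proof of Thm 7.2 pp. 65–66] -/
theorem thm_7_2_of_prop_13_4 (h134 : X.Prop_13_4) (hG : X.GlobalToLocal) (hS : X.ArchSignature) :
    X.toBMMSpectrum.Thm_7_2 := by
  intro a b πf hdeg hπ
  obtain ⟨W, hdim, hW⟩ := h134 a b πf hdeg hπ
  exact ⟨W, sigInf_eq_of_isThetaLiftFrom hG hS hdeg hdim hW, hW⟩

/-- K. Conversely Theorem 7.2 gives Proposition 13.4 in the typed form (a `W` of signature `(a,b)` has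
`dim W = a + b`); so, GIVEN the global-to-local step and Paul's sentence, the typed Proposition 13.4 and the typed
Theorem 7.2 are equivalent. [cite: BergeronMillsonMoeglin2016Balls, Thm 7.2 p. 65] -/
theorem prop_13_4_of_thm_7_2 (h : X.toBMMSpectrum.Thm_7_2) : X.Prop_13_4 := by
  intro a b πf hdeg hπ
  obtain ⟨W, hsig, hW⟩ := h a b πf hdeg hπ
  exact ⟨W, by simp [BMMSpectrum.dimW, hsig], hW⟩

/-- K. DEGREE ONE (`m ≥ 3`): a global `ψ`-theta lift `A(1×q,0×q) ⊗ π_f` from the unitary group of a LINE `W`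
(`dim W = 1`) forces `W` to have signature `(0,1)` at infinity, and `A(0×q,1×q) ⊗ π_f` forces `(1,0)`.
[cite: BergeronMillsonMoeglin2016Balls, proof of Thm 7.2 pp. 65–66] -/
theorem sigInf_eq_of_isThetaLiftFrom_degree_one (hG : X.GlobalToLocal) (hS : X.ArchSignature) (hm : 3 ≤ X.m)
    {πf : X.RepF} {W : X.SkewHerm} (hdim : X.dimW W = 1) :
    (X.IsThetaLiftFrom (X.A 1 0) πf W → X.sigInf W = (0, 1)) ∧
    (X.IsThetaLiftFrom (X.A 0 1) πf W → X.sigInf W = (1, 0)) :=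
  ⟨fun hW => sigInf_eq_of_isThetaLiftFrom hG hS (X.degreeBound_of_add_eq_one (by norm_num) hm) hdim hW,
   fun hW => sigInf_eq_of_isThetaLiftFrom hG hS (X.degreeBound_of_add_eq_one (by norm_num) hm) hdim hW⟩

/-- P-step (weakest form). **The global-to-local step restricted to what the printed proof of Theorem 7.2 consumes**:
for `π_∞ = A(b×q, a×q)` with `3(a+b)+|a−b| < 2m` and `dim W = a+b`, a global `ψ`-theta lift `A(b×q,a×q) ⊗ π_f` from
`U(W)` has `A(b×q,a×q)` in the image of the local theta correspondence from `U(W, ℂ/ℝ)`, of signature `sig_∞(W)`.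
Implied by `GlobalToLocal`; at `m = 3` implied by the printed stable-range theorem `GlobalToLocalStable`.  Nothing
is asserted.
[cite: BergeronMillsonMoeglin2016Balls, proof of Thm 7.2 pp. 65–66] -/
def GlobalToLocalDeg (X : BMMArchSpectrum.{u}) : Prop :=
  ∀ (a b : ℕ) (πf : X.RepF) (W : X.SkewHerm), X.degreeBound a b → X.dimW W = a + b →
    X.IsThetaLiftFrom (X.A b a) πf W → X.IsLocalThetaLiftFrom (X.A b a) (X.sigInf W)

/-- P. **Li's stable-range theorem, AS PRINTED in [CossuttaMarshall2012]** (§2, held arXiv:1106.2765 chunk p0007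
L61–65; "proven by Li in [Li2]" = [Li1992]): under `n > 2n' + 4d − 2` — in the unitary case `d = 1/2`, i.e.
`n > 2n'` — for a cusp form `π` on `G' = U(V')`: "`θ_φ(f,h)` is square integrable, and nonzero for some choice of
`f ∈ π` and `φ ∈ S(X(𝔸))`.  If `Θ(π,V)` is the subspace of `L²(G(F)\G(𝔸))` generated by the functions `θ_φ(f,h)`
under the action of `G(𝔸)`, then `Θ(π,V)` is an irreducible automorphic representation which is isomorphic to
`⊗_v θ(π_v, V_v)`."  TYPING (BMM's `W` = C–M's `V'`, `n' = dim W`, `n = m`): if `π_∞ ⊗ π_f ∈ 𝒜^c(U(V))` is in the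
image of the cuspidal `ψ`-theta correspondence from `U(W)` with `2·dim W < m`, then `π_∞` — the archimedean component
of the irreducible `Θ(π', V) ≅ ⊗_v θ(π'_v, V_v)` — is in the image of the LOCAL theta correspondence from
`U(W)(F_∞) = U(W, ℂ/ℝ)`, a group of signature `sig_∞(W)`.  Nothing is asserted.
[cite: CossuttaMarshall2012, §2 Theorem (after Li 1992), arXiv:1106.2765 chunk p0007 L61–65] -/
def GlobalToLocalStable (X : BMMArchSpectrum.{u}) : Prop :=
  ∀ (πinf : X.CohInf) (πf : X.RepF) (W : X.SkewHerm), 2 * X.dimW W < X.m →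
    X.IsThetaLiftFrom πinf πf W → X.IsLocalThetaLiftFrom πinf (X.sigInf W)

/-- K. The general step implies its restricted form.
[cite: BergeronMillsonMoeglin2016Balls, proof of Thm 7.2 pp. 65–66] -/
theorem globalToLocalDeg_of_globalToLocal (hG : X.GlobalToLocal) : X.GlobalToLocalDeg :=
  fun a b πf W _ _ hW => hG (X.A b a) πf W hW

/-- K. At `m = 3`, BMM's degree bound `3(a+b)+|a−b| < 2m` forces `a + b ≤ 1`, hence the stable range
`2(a+b) < m` (elementary arithmetic). [folklore] -/
theorem two_mul_add_lt_of_degreeBound_three (hm : X.m = 3) {a b : ℕ} (h : X.degreeBound a b) :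
    2 * (a + b) < X.m := by
  have h0 : (0 : ℤ) ≤ |(a : ℤ) - b| := abs_nonneg _
  simp only [BMMSpectrum.degreeBound, hm] at h
  push_cast at h
  omega

/-- K. **At `m = 3` the printed stable-range theorem supplies the global-to-local step** of the proof of Thm 7.2.
[cite: CossuttaMarshall2012, §2 Theorem (after Li 1992), arXiv:1106.2765 chunk p0007 L61–65] -/
theorem globalToLocalDeg_of_stable (hm : X.m = 3) (hG : X.GlobalToLocalStable) : X.GlobalToLocalDeg := by
  intro a b πf W hdeg hdim hW
  refine hG (X.A b a) πf W ?_ hW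
  rw [hdim]
  exact two_mul_add_lt_of_degreeBound_three hm hdeg

/-- K. **The printed proof of Theorem 7.2 from its weakest typed inputs**: Proposition 13.4, the restricted
global-to-local step, Paul's sentence. [cite: BergeronMillsonMoeglin2016Balls, proof of Thm 7.2 pp. 65–66] -/
theorem thm_7_2_of_prop_13_4_deg (h134 : X.Prop_13_4) (hG : X.GlobalToLocalDeg) (hS : X.ArchSignature) :
    X.toBMMSpectrum.Thm_7_2 := by
  intro a b πf hdeg hπ
  obtain ⟨W, hdim, hW⟩ := h134 a b πf hdeg hπ
  have hloc : X.IsLocalThetaLiftFrom (X.A b a) ((X.sigInf W).1, (X.sigInf W).2) := hG a b πf W hdeg hdim hW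
  exact ⟨W, (hS a b (X.sigInf W).1 (X.sigInf W).2 hdeg hdim).mp hloc, hW⟩

/-- K. **Theorem 7.2 at `m = 3` from PRINTED statements only**: Proposition 13.4 [BMM16], Li's stable-range theorem
as printed in [CossuttaMarshall2012], and Paul's signature sentence [BMM16, p. 66].  ("Printed" ≠ "unconditional":
the hypothesis `Prop_13_4` carries the source's printed dependence on Arthur's endoscopic classification — see its
docstring; the other two inputs are unconditional printed theorems.)
[cite: BergeronMillsonMoeglin2016Balls, proof of Thm 7.2 pp. 65–66] -/
theorem thm_7_2_of_prop_13_4_stable (hm : X.m = 3) (h134 : X.Prop_13_4) (hG : X.GlobalToLocalStable)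
    (hS : X.ArchSignature) : X.toBMMSpectrum.Thm_7_2 :=
  thm_7_2_of_prop_13_4_deg h134 (globalToLocalDeg_of_stable hm hG) hS

/-- K. Signature corollary in the stable range: a global `ψ`-theta lift `A(b×q,a×q) ⊗ π_f` from `U(W)` with
`dim W = a+b`, `2(a+b) < m` and `3(a+b)+|a−b| < 2m` has `sig_∞(W) = (a,b)`.
[cite: BergeronMillsonMoeglin2016Balls, proof of Thm 7.2 pp. 65–66] -/
theorem sigInf_eq_of_isThetaLiftFrom_stable (hG : X.GlobalToLocalStable) (hS : X.ArchSignature) {a b : ℕ}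
    {πf : X.RepF} {W : X.SkewHerm} (hdeg : X.degreeBound a b) (hdim : X.dimW W = a + b)
    (hlt : 2 * (a + b) < X.m) (hW : X.IsThetaLiftFrom (X.A b a) πf W) : X.sigInf W = (a, b) := by
  have hloc : X.IsLocalThetaLiftFrom (X.A b a) ((X.sigInf W).1, (X.sigInf W).2) :=
    hG (X.A b a) πf W (by rw [hdim]; exact hlt) hW
  exact (hS a b (X.sigInf W).1 (X.sigInf W).2 hdeg hdim).mp hloc

end BMMArchSpectrum

end Literature.RepresentationTheory.BergeronMillsonMoeglin2016
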